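import Literature.MathematicalPhysics.QuantumFieldTheory.Balaban1983to89.B8Ineq159FlatCovPrintedRec
import Literature.MathematicalPhysics.QuantumFieldTheory.Balaban1983to89.B8Ineq159FlatDentedCubeMemberSCGamma
import Literature.MathematicalPhysics.QuantumFieldTheory.Balaban1983to89.B8Ineq159FlatMapsRec
import Literature.MathematicalPhysics.QuantumFieldTheory.Balaban1983to89.B8DentedCubeMemberZdRec
import Literature.MathematicalPhysics.QuantumFieldTheory.Balaban1983to89.B8Eq191FlatLettersDentedCubeMemberRec

/-!
# `Balaban1983to89.B8Ineq159FlatDentedCubeMemberSCGammaRec` — RECORD TWIN of `B8Ineq159FlatDentedCubeMemberSCGamma` ([Balaban1985RegularSpaces] (1.59) p. 86 ∕ (1.62)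
# p. 87 AT `U₀ = 1` ON THE DENTED CENTRED CUBE MEMBER, EVERY TRUNCATION: print's POINTWISE form ⟹ the flat line's SCALAR four-line clause; the uniform clause from the TWO
# named facts OF RECORD `Ineq159FlatCubeMemberCovPrintedZ` ∕ `Ineq159FlatDentedCubeMemberCovPrintedZ`) — item R6 (f) of the record crown (desk `R6-PLAN.md` §5; bus FINDING-1)

statement-level skeleton of published theorems with citation tags; proofs where landed; nothing here is a claim about the Yang–Mills mass gap

T. Bałaban, *Spaces of regular gauge field configurations on a lattice and gauge fixing conditions*, Commun. Math. Phys. **99** (1985) 75–102 `[Balaban1985RegularSpaces]`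
("[6]"): (1.55)–(1.62) pp. 86–87, (1.31) p. 82, (1.131) p. 99, p. 98, p. 77; T. Bałaban, *The variational problem and background fields in renormalization group method for
lattice gauge theories*, Commun. Math. Phys. **102** (1985) 277–309 `[Balaban1985Variational]` ("[15]"): (148)–(152) p. 301; T. Bałaban, *Propagators for lattice gauge
theories in a background field*, Commun. Math. Phys. **99** (1985) 389–434 `[Balaban1985BackgroundPropagators]` ("[4]"): (3.13)–(3.16) p. 393, Thm 3.3 p. 399; T. Bałaban,
*Propagators and renormalization transformations for lattice gauge theories. II*, Commun. Math. Phys. **96** (1984) 223–250 `[Balaban1984PropagatorsII]` ("[B6]"): (2.3)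
p. 224; T. Bałaban, *Averaging operations for lattice gauge theories*, Commun. Math. Phys. **98** (1985) 17–51 `[Balaban1985Averaging]` ("[3]"): (127)–(128) p. 37;
T. Bałaban, *Renormalization group approach to lattice gauge field theories. I*, Commun. Math. Phys. **109** (1987) 249–301 `[Balaban1987RG1]` ("[I]"): (0.3)–(0.4)
pp. 252–253.  STATUS: published, refereed.

CITATION HEADER (lean-in-tree rule).  Cell `pub-ymgap`, «N05-REC» stage 2 (director-ym №254∕№255∕№288), item R6 (f) — typed by the LEAD PEN dag-n05-e g39 (inventory
`N05-REC-INVENTORY.md` §R6 row `B8Ineq159FlatDentedCubeMemberSCGamma`: A `sc4_of_pointwise159_dented`, `sc4_dented_of_ineq159Printed`; dag-n07-w3 TAKE-7 ∕ HANDBACK-7).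
WHAT IS REPRODUCED = ✓ the engine module (seat `pub-ymgap-dag-n05-e` g31) under the token map `CubeB8D ↦ CubeB8DZ`, `IsLandau138 ↦ IsLandau138Z`,
`linCovIter L 1 ↦ linCovIterZ L 1` (the RECORD's linearised averaging [4] (3.14)–(3.15) at the flat background — bus FINDING-1: NOT the straight `linQIterZ`), print's classes
`cubeLamBP ∕ c.lamBP ↦ cubeLamBPZ ∕ c.lamBPZ` (dag-n05-e g38 ∕ dag-n07-w3), split class `c.lamBPT` (g38's `B8DentedCubeMemberZdRec`), named facts ↦ the RECORD-operator facts
`B8Ineq159FlatCovPrintedRec.Ineq159FlatCubeMemberCovPrintedZ ∕ Ineq159FlatDentedCubeMemberCovPrintedZ` (NAMED, NOT proved).  Differences from the engine, all inside proofs: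
§1's finiteness of the side-touching pairs is read off `Ω′_j ⊆ Ω′₀ = □₀` (dag-n07-w3's `sq_subset_zero`, `CubeB8DZ.sq_zero`, `inBox_widen_of_sideTouches`) instead of the pure
member's lemma; the finite bound of the `wsup` members is g38's `B8Ineq159FlatMapsRec.norm_linCovIterZ_one_le` (straight iterate + carried letter) instead of
`linCovIter_one_left`; §2's inclusion of print's full class in the γ split index is TRANSPORTED from the engine's `lamBPF_sub_splitIndex` at the translated datum `c.translate`
through the label-shift dictionaries (`mem_cubeLamBPZ_iff_add_ctrShift`, `CubeB8DZ.mem_lamBPZ_iff_add_ctrShift`, `mem_lamBPT_iff_add_ctrShift`, `image_add_ctrShift_sq`,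
`bondTouches_translate_iff`) — no new `def` (print's full class is written `if m < c.k then cubeLamBPZ … m j else c.lamBPZ j`).  THEOREM NAMES = the engine's (namespace
`…SCGammaRec`).  Kind «kernel-checked proof», theorems only; no `def`, no `instance`, no `notation`, no existing module modified.  `--supports stmt-QuantumFields-20541`
(K0⁷-keyed, COUNT-NEUTRAL).

HONEST SCOPE: §1, §2 unconditional; §3 CONDITIONAL on the two named facts of record ([4] Thm 3.3 ∕ [6] (1.59), (1.62) for the record operator; UNPROVED in the tree — their
straight-datum twins are proved but are not these).  Nothing of [3]∕[4]∕[6]∕[15]∕[B6]∕[I] newly proved; `HThm4Rec` UNDISCHARGED; N05 ∕ N07 NOT discharged; COUNT of record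
unmoved · K numerically unchanged; one finite `𝕋⁴` programme at fixed `ε`, Bałaban AS PRINTED; nothing continuum ∕ ℝ⁴ ∕ OS ∕ mass-gap ∕ Clay.  No `sorry`, no `def`.

[cite: Balaban1985RegularSpaces, (1.59) p.86, (1.62) p.87, (1.55) p.86, (1.31) p.82, (1.131) p.99, p.98, p.77; Balaban1985Variational, (148)–(152) p.301;
Balaban1985BackgroundPropagators, (3.14)–(3.15) p.393, Theorem 3.3 p.399; Balaban1984PropagatorsII, (2.3) p.224; Balaban1985Averaging, (127)–(128) p.37; Balaban1987RG1,
(0.3)–(0.4) pp.252–253]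
-/

noncomputable section

namespace Literature.MathematicalPhysics.QuantumFieldTheory.Balaban1983to89.B8Ineq159FlatDentedCubeMemberSCGammaRec

open scoped Matrix
open Finset (range)
open B7Prop1Explicit B7Prop2Explicit B7Prop1Local
open BlockAveragingZd (ctrShift)
open B7SectEFLinearisationRec (linCovIterZ)
open B8Ineq132 (covDerivFwd BondTouches Under)
open B8Eq140Level (SideTouches sideTouches_mono sideTouches_of_bondTouches)
open B8Eq143PlaqExpansion (pdiv)
open B8Eq146AExpansion (iEta plaqCovDeriv)
open B8Eq155JBound (Jcur wsup wsup_le le_wsup wsup_nonneg)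
open B8ScaledSupNorm (weight msup Bdd bondNorm msup_le msup_nonneg weight_mul_norm_le_msup weight_neg_natCast weight_nonneg)
open B8Eq138LandauZd (covLap)
open B8Eq138LandauZdRec (IsLandau138Z)
open B8Eq131CubesRec (cubeZ sqLoZ sqHiZ)
open B8Eq131CubesAdmissibleRec (cubeFamZ cubeFam_false_of_le cubeFam_false_zero)
open B8Ineq130Rec (tlo thi)
open B8CubeMemberZdRec (cubeLamSZ)
open B8Ineq159FlatCubeMemberPrintedRec (cubeLamBPZ mem_cubeLamBPZ_iff_add_ctrShift)
open B8Ineq159FlatCovPrintedRec (Ineq159FlatCubeMemberCovPrintedZ Ineq159FlatDentedCubeMemberCovPrintedZ)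
open B8Ineq159FlatCubeMemberPerCube (inBox_widen_of_sideTouches)
open B8Eq191FlatLettersCubeMember (inBox_finite)
open B9SupplySockB9P3ZdBeta (CrossB)
open B8Ineq159FlatMaps (norm_Jcur_flat_le)
open B8Ineq159FlatMapsRec (norm_linCovIterZ_one_le)
open B8Ineq159FlatDentedCubeMemberSCGamma (lamBPF_of_lt lamBPF_top)
open B8DentedCubeMemberZdRec (lamST_of_lt lamST_top_apply mem_lamBPT_iff_add_ctrShift)
open B8Eq191FlatLettersDentedCubeMemberRec (sq_subset_zero)
open Node00 (CubeB8DZ bondTouches_translate_iff)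
open Literature.MathematicalPhysics.QuantumLattice (blockMap)

export B7Prop1Explicit (Site)

variable {d : ℕ}

/-! ## §1 The pointwise body at one dented datum ⟹ the scalar four-line clause, any averaging class `Cl`, any index `⊇ Cl`, `B_∂ := B₀` -/

/-- ★★ **(1.59) AT `U₀ = 1` ON THE DENTED MEMBER, ONE DATUM: PRINT's POINTWISE FORM ⟹ THE FLAT LINE's SCALAR FOUR-LINE CLAUSE** — Fγ10a's `sc4_of_pointwise159` on the dented
tower `c.sq` with the truncated dented cells `c.lamST m` and an ARBITRARY averaging class `Cl` (print's `cubeLamBP … m` below the top, `c.lamBP` at the top): if the pointwise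
body holds with `B₀ ≥ 1` for every `φ` in the flat Landau gauge with the support clause, then for every index predicate `I ⊇ Cl` the four-line clause holds in the tree's norms,
`B_∂ := B₀`.  PROOF = Fγ10a's (finite support ⟹ the three right-hand suprema are attained; `N := |J|₍₋₃₎ + wsup + Φ₀`); the side-touching pairs of the dented tower are among the pure
member's (`Ω′_j ⊆ □_j`). [cite: Balaban1985RegularSpaces, (1.59) p.86, (1.62) p.87, (1.55) p.86, (1.31) p.82, (1.131) p.99, p.77; Balaban1985Variational, (148)–(152) p.301; Balaban1985BackgroundPropagators, Thm 3.3 p.399; Balaban1984PropagatorsII, (2.3) p.224] -/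
theorem sc4_of_pointwise159_dented (hd2 : 2 ≤ d) {L s : ℕ} (hLs : L = 2 * s + 1) {η : ℝ} (hη : 0 < η) {K : ℕ} {Ω : ℕ → Set (Site d)}
    (c : CubeB8DZ d L K Ω) {m : ℕ} (_hmk : m ≤ c.k) {B₀ : ℝ} (hB₀ : 1 ≤ B₀) (Cl : ℕ → Set (Site d × Fin d))
    (I : ℕ → Site d × Fin d → Prop) (hI : ∀ j, j ≤ m → ∀ b ∈ Cl j, I j b)
    (hbody : ∀ φ : Site d → Fin d → ℂ,
      IsLandau138Z L m η (c.sq 0) (c.lamST m) (1 : Site d → Fin d → ℂˣ) φ →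
      (∀ (y : Site d) (τ : Fin d), (∀ j, j ≤ m → ¬ SideTouches (c.sq j) y τ) → φ y τ = 0) →
      ∀ N : ℝ, 0 ≤ N →
        (∀ j, j ≤ m → ∀ (y : Site d) (τ : Fin d), BondTouches (c.sq j) y τ →
            ((L : ℝ) ^ j * η) ^ 3 * ‖Jcur η (1 : Site d → Fin d → ℂˣ) φ τ y‖ ≤ N) →
        (∀ j, j ≤ m → ∀ b ∈ Cl j,
            ‖linCovIterZ L (1 : Site d → Fin d → ℂˣ) (iEta η φ) j b.1 b.2‖ ≤ N) →
        (∀ (y : Site d) (τ : Fin d), ¬ BondTouches (c.sq 0) y τ → η * ‖φ y τ‖ ≤ N) →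
        ∀ j, j ≤ m → ∀ (y : Site d) (τ : Fin d), SideTouches (c.sq j) y τ →
          ((L : ℝ) ^ j * η) * ‖φ y τ‖ ≤ B₀ * N ∧
          (∀ ν : Fin d, ((L : ℝ) ^ j * η) ^ 2 *
            ‖covDerivFwd η (1 : Site d → Fin d → ℂˣ) ν (fun z => φ z τ) y‖ ≤ B₀ * N) ∧
          ((L : ℝ) ^ j * η) ^ 3 * ‖covLap η (1 : Site d → Fin d → ℂˣ) (fun z => φ z τ) y‖ ≤ B₀ * N)
    (φ : Site d → Fin d → ℂ)
    (hLan : IsLandau138Z L m η (c.sq 0) (c.lamST m) (1 : Site d → Fin d → ℂˣ) φ)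
    (hsupp : ∀ (y : Site d) (τ : Fin d), (∀ j, j ≤ m → ¬ SideTouches (c.sq j) y τ) → φ y τ = 0) :
    msup L m η (-(1 : ℝ)) (fun j (b : Site d × Fin d) => SideTouches (c.sq j) b.1 b.2) (fun b => φ b.1 b.2)
        ≤ B₀ * (bondNorm L m η (-(3 : ℝ)) c.sq (fun x μ => Jcur η (1 : Site d → Fin d → ℂˣ) φ μ x)
          + wsup 1 (fun p : {p : ℕ × (Site d × Fin d) // p.1 ≤ m ∧ I p.1 p.2} =>
              linCovIterZ L (1 : Site d → Fin d → ℂˣ) (iEta η φ) p.1.1 p.1.2.1 p.1.2.2))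
          + B₀ * msup L m η (-(1 : ℝ)) (fun j (b : Site d × Fin d) => j = 0 ∧ SideTouches (c.sq 0) b.1 b.2 ∧
              ¬ BondTouches (c.sq 0) b.1 b.2) (fun b => φ b.1 b.2) ∧
      msup L m η (-(2 : ℝ)) (fun j (t : Fin d × Fin d × Site d) => SideTouches (c.sq j) t.2.2 t.2.1)
          (fun t => covDerivFwd η (1 : Site d → Fin d → ℂˣ) t.1 (fun z => φ z t.2.1) t.2.2)
        ≤ B₀ * (bondNorm L m η (-(3 : ℝ)) c.sq (fun x μ => Jcur η (1 : Site d → Fin d → ℂˣ) φ μ x)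
          + wsup 1 (fun p : {p : ℕ × (Site d × Fin d) // p.1 ≤ m ∧ I p.1 p.2} =>
              linCovIterZ L (1 : Site d → Fin d → ℂˣ) (iEta η φ) p.1.1 p.1.2.1 p.1.2.2))
          + B₀ * msup L m η (-(1 : ℝ)) (fun j (b : Site d × Fin d) => j = 0 ∧ SideTouches (c.sq 0) b.1 b.2 ∧
              ¬ BondTouches (c.sq 0) b.1 b.2) (fun b => φ b.1 b.2) ∧
      bondNorm L m η (-(3 : ℝ)) c.sq
          (fun x μ => pdiv η (1 : Site d → Fin d → ℂˣ) (plaqCovDeriv η (1 : Site d → Fin d → ℂˣ) φ) μ x)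
        ≤ B₀ * (bondNorm L m η (-(3 : ℝ)) c.sq (fun x μ => Jcur η (1 : Site d → Fin d → ℂˣ) φ μ x)
          + wsup 1 (fun p : {p : ℕ × (Site d × Fin d) // p.1 ≤ m ∧ I p.1 p.2} =>
              linCovIterZ L (1 : Site d → Fin d → ℂˣ) (iEta η φ) p.1.1 p.1.2.1 p.1.2.2))
          + B₀ * msup L m η (-(1 : ℝ)) (fun j (b : Site d × Fin d) => j = 0 ∧ SideTouches (c.sq 0) b.1 b.2 ∧
              ¬ BondTouches (c.sq 0) b.1 b.2) (fun b => φ b.1 b.2) ∧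
      bondNorm L m η (-(3 : ℝ)) c.sq (fun x μ => covLap η (1 : Site d → Fin d → ℂˣ) (fun z => φ z μ) x)
        ≤ B₀ * (bondNorm L m η (-(3 : ℝ)) c.sq (fun x μ => Jcur η (1 : Site d → Fin d → ℂˣ) φ μ x)
          + wsup 1 (fun p : {p : ℕ × (Site d × Fin d) // p.1 ≤ m ∧ I p.1 p.2} =>
              linCovIterZ L (1 : Site d → Fin d → ℂˣ) (iEta η φ) p.1.1 p.1.2.1 p.1.2.2))
          + B₀ * msup L m η (-(1 : ℝ)) (fun j (b : Site d × Fin d) => j = 0 ∧ SideTouches (c.sq 0) b.1 b.2 ∧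
              ¬ BondTouches (c.sq 0) b.1 b.2) (fun b => φ b.1 b.2) := by
  -- abbreviations for the three right-hand members
  obtain ⟨X, hX⟩ : ∃ X : ℝ, X = bondNorm L m η (-(3 : ℝ)) c.sq (fun x μ => Jcur η (1 : Site d → Fin d → ℂˣ) φ μ x) :=
    ⟨_, rfl⟩
  obtain ⟨Y, hY⟩ : ∃ Y : ℝ, Y = wsup 1 (fun p : {p : ℕ × (Site d × Fin d) // p.1 ≤ m ∧ I p.1 p.2} =>
      linCovIterZ L (1 : Site d → Fin d → ℂˣ) (iEta η φ) p.1.1 p.1.2.1 p.1.2.2) := ⟨_, rfl⟩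
  obtain ⟨Z, hZ⟩ : ∃ Z : ℝ, Z = msup L m η (-(1 : ℝ)) (fun j (b : Site d × Fin d) => j = 0 ∧ SideTouches (c.sq 0) b.1 b.2 ∧
      ¬ BondTouches (c.sq 0) b.1 b.2) (fun b => φ b.1 b.2) := ⟨_, rfl⟩
  have hJX : bondNorm L m η (-(3 : ℝ)) c.sq
      (fun x μ => pdiv η (1 : Site d → Fin d → ℂˣ) (plaqCovDeriv η (1 : Site d → Fin d → ℂˣ) φ) μ x) = X := by rw [hX]; rfl
  rw [hJX, ← hX, ← hY, ← hZ]
  have hL : 1 ≤ L := by omega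
  have hLo : Odd L := ⟨s, by omega⟩
  have hL1 : (1 : ℝ) ≤ L := by exact_mod_cast hL
  have hX0 : 0 ≤ X := by rw [hX]; exact msup_nonneg L m hη.le _ _ _
  have hY0 : 0 ≤ Y := by rw [hY]; exact wsup_nonneg zero_le_one _
  have hZ0 : 0 ≤ Z := by rw [hZ]; exact msup_nonneg L m hη.le _ _ _
  have hB₀0 : 0 ≤ B₀ := zero_le_one.trans hB₀
  -- weights
  have hw3 : ∀ j : ℕ, weight L η (-(3 : ℝ)) j = ((L : ℝ) ^ j * η) ^ 3 := fun j => by simpa using weight_neg_natCast L η 3 j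
  have hw2 : ∀ j : ℕ, weight L η (-(2 : ℝ)) j = ((L : ℝ) ^ j * η) ^ 2 := fun j => by simpa using weight_neg_natCast L η 2 j
  have hw1 : ∀ j : ℕ, weight L η (-(1 : ℝ)) j = (L : ℝ) ^ j * η := fun j => by simpa using weight_neg_natCast L η 1 j
  have hscale : ∀ j, j ≤ m → (L : ℝ) ^ j * η ≤ (L : ℝ) ^ m * η := fun j hj =>
    mul_le_mul_of_nonneg_right (pow_le_pow_right₀ hL1 hj) hη.le
  have hscale0 : ∀ j : ℕ, 0 ≤ (L : ℝ) ^ j * η := fun j => by positivity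
  -- Step 1: `φ` is finitely supported, hence uniformly bounded
  obtain ⟨C, hC0, hC⟩ : ∃ C : ℝ, 0 ≤ C ∧ ∀ (y : Site d) (τ : Fin d), ‖φ y τ‖ ≤ C := by
    have hfin : {q : ℕ × (Site d × Fin d) | q.1 ≤ m ∧ SideTouches (c.sq q.1) q.2.1 q.2.2}.Finite := by
      refine (((Finset.range (m + 1)).finite_toSet).prod
        ((inBox_finite (tlo L (sqLoZ L c.a c.ρ c.k 0) 0 - 2) (thi L (sqHiZ L c.a c.M c.ρ c.k 0) 0 + 1)).prod
          (Set.finite_univ (α := Fin d)))).subset ?_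
      rintro ⟨j, y, τ⟩ ⟨hj, hs⟩
      simp only [Set.mem_prod, Finset.coe_range, Set.mem_Iio, Set.mem_setOf_eq, Set.mem_univ, and_true]
      refine ⟨Nat.lt_succ_of_le hj, ?_⟩
      have hsub : c.sq j ⊆ {x | InBox (tlo L (sqLoZ L c.a c.ρ c.k 0) 0) (thi L (sqHiZ L c.a c.M c.ρ c.k 0) 0) x} := by
        intro x hx
        have hx0 : x ∈ c.sq 0 := sq_subset_zero c hLo j hx
        rw [c.sq_zero] at hx0
        exact hx0
      exact inBox_widen_of_sideTouches (sideTouches_mono hsub hs)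
    obtain ⟨C, hC⟩ := (hfin.image fun q : ℕ × (Site d × Fin d) => ‖φ q.2.1 q.2.2‖).bddAbove
    refine ⟨max C 0, le_max_right _ _, fun y τ => ?_⟩
    by_cases h : ∃ j, j ≤ m ∧ SideTouches (c.sq j) y τ
    · obtain ⟨j, hj, hs⟩ := h
      have hmem : ‖φ y τ‖ ∈ (fun q : ℕ × (Site d × Fin d) => ‖φ q.2.1 q.2.2‖) ''
          {q : ℕ × (Site d × Fin d) | q.1 ≤ m ∧ SideTouches (c.sq q.1) q.2.1 q.2.2} :=
        ⟨(j, (y, τ)), ⟨hj, hs⟩, rfl⟩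
      exact (hC hmem).trans (le_max_left _ _)
    · simp only [not_exists, not_and] at h
      rw [hsupp y τ fun j hj hs => h j hj hs, norm_zero]
      exact le_max_right _ _
  -- Step 2: the `Bdd` side conditions of the three right-hand families, and the member-below-sup facts
  obtain ⟨J₀, hJ₀⟩ : ∃ J₀ : ℝ, J₀ =
      (d : ℝ) * (η⁻¹ * ((η⁻¹ * (C + C) + η⁻¹ * (C + C)) + (η⁻¹ * (C + C) + η⁻¹ * (C + C)))) +
      (d : ℝ) * (η⁻¹ * ((η⁻¹ * (C + C) + η⁻¹ * (C + C)) + (η⁻¹ * (C + C) + η⁻¹ * (C + C)))) := ⟨_, rfl⟩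
  have hJ₀0 : 0 ≤ J₀ := by rw [hJ₀]; positivity
  have hJbd : ∀ (μ : Fin d) (x : Site d), ‖Jcur η (1 : Site d → Fin d → ℂˣ) φ μ x‖ ≤ J₀ := fun μ x => by
    rw [hJ₀]; exact norm_Jcur_flat_le hη hC0 hC μ x
  have hBddJ : Bdd L m η (-(3 : ℝ)) (fun j (b : Site d × Fin d) => BondTouches (c.sq j) b.1 b.2)
      (fun b => Jcur η (1 : Site d → Fin d → ℂˣ) φ b.2 b.1) := by
    refine ⟨((L : ℝ) ^ m * η) ^ 3 * J₀, fun j hj b _ => ?_⟩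
    rw [hw3]
    exact mul_le_mul (pow_le_pow_left₀ (hscale0 j) (hscale j hj) 3) (hJbd _ _) (norm_nonneg _) (by positivity)
  have hiEta : ∀ (y : Site d) (κ : Fin d), ‖iEta η φ y κ‖ ≤ η * C := fun y κ => B8Eq146AExpansion.norm_iEta_le hη.le hC y κ
  have hηC : 0 ≤ η * C := by positivity
  have hQbd : ∀ p : {p : ℕ × (Site d × Fin d) // p.1 ≤ m ∧ I p.1 p.2},
      1 * ‖linCovIterZ L (1 : Site d → Fin d → ℂˣ) (iEta η φ) p.1.1 p.1.2.1 p.1.2.2‖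
        ≤ ((L : ℝ) ^ m + 8 * ((d : ℝ) * s) ^ 2 * ∑ i ∈ range m, ((L : ℝ) ^ 2) ^ i) * (η * C) := by
    intro p
    rw [one_mul]
    refine (norm_linCovIterZ_one_le hLs _ hηC hiEta p.1.1 p.1.2.1 p.1.2.2).trans (mul_le_mul_of_nonneg_right ?_ hηC)
    have h1 : (L : ℝ) ^ p.1.1 ≤ (L : ℝ) ^ m := pow_le_pow_right₀ hL1 p.2.1
    have h2 : ∑ i ∈ range p.1.1, ((L : ℝ) ^ 2) ^ i ≤ ∑ i ∈ range m, ((L : ℝ) ^ 2) ^ i :=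
      Finset.sum_le_sum_of_subset_of_nonneg (Finset.range_mono p.2.1) fun i _ _ => by positivity
    have h3 : 0 ≤ 8 * ((d : ℝ) * s) ^ 2 := by positivity
    nlinarith [h1, h2, h3]
  have hBddZ : Bdd L m η (-(1 : ℝ)) (fun j (b : Site d × Fin d) => j = 0 ∧ SideTouches (c.sq 0) b.1 b.2 ∧
      ¬ BondTouches (c.sq 0) b.1 b.2) (fun b => φ b.1 b.2) := by
    refine ⟨((L : ℝ) ^ m * η) * C, fun j hj b _ => ?_⟩
    rw [hw1]
    exact mul_le_mul (hscale j hj) (hC _ _) (norm_nonneg _) (by positivity)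
  -- (i): every weighted `J` member is below `X`
  have hi : ∀ j, j ≤ m → ∀ (y : Site d) (τ : Fin d), BondTouches (c.sq j) y τ →
      ((L : ℝ) ^ j * η) ^ 3 * ‖Jcur η (1 : Site d → Fin d → ℂˣ) φ τ y‖ ≤ X + Y + Z := by
    intro j hj y τ hb
    have h := weight_mul_norm_le_msup hBddJ hj (i := (y, τ)) hb
    rw [hw3] at h
    have h' : ((L : ℝ) ^ j * η) ^ 3 * ‖Jcur η (1 : Site d → Fin d → ℂˣ) φ τ y‖ ≤ X := by rw [hX]; exact h
    linarith
  -- (ii): every averaging member on print's class is below `Y` (print's class lies in the index)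
  have hii : ∀ j, j ≤ m → ∀ b ∈ Cl j,
      ‖linCovIterZ L (1 : Site d → Fin d → ℂˣ) (iEta η φ) j b.1 b.2‖ ≤ X + Y + Z := by
    intro j hj b hb
    have h := le_wsup hQbd ⟨(j, b), hj, hI j hj b hb⟩
    rw [one_mul] at h
    have h' : ‖linCovIterZ L (1 : Site d → Fin d → ℂˣ) (iEta η φ) j b.1 b.2‖ ≤ Y := by rw [hY]; exact h
    linarith
  -- (iii): off the bonds of `□₀`, `η|φ|` is below the exterior-collar term `Z` (or `φ = 0`)
  have hiii : ∀ (y : Site d) (τ : Fin d), ¬ BondTouches (c.sq 0) y τ → η * ‖φ y τ‖ ≤ X + Y + Z := by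
    intro y τ hnb
    by_cases hs : SideTouches (c.sq 0) y τ
    · have h := weight_mul_norm_le_msup hBddZ (Nat.zero_le m) (i := (y, τ)) ⟨rfl, hs, hnb⟩
      rw [hw1, pow_zero, one_mul] at h
      have h' : η * ‖φ y τ‖ ≤ Z := by rw [hZ]; exact h
      linarith
    · have h0 : φ y τ = 0 := by
        refine hsupp y τ fun j _ hsj => hs ?_
        exact sideTouches_mono (sq_subset_zero c hLo j) hsj
      rw [h0, norm_zero, mul_zero]
      positivity
  -- every bond is a side of a plaquette (`d ≥ 2`)
  haveI : Nontrivial (Fin d) := Fin.nontrivial_iff_two_le.mpr hd2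
  have hbs : ∀ (y : Site d) (τ : Fin d) (j : ℕ), BondTouches (c.sq j) y τ →
      SideTouches (c.sq j) y τ := fun y τ j hb => by
    obtain ⟨κ, hκ⟩ := exists_ne τ
    exact sideTouches_of_bondTouches hκ hb
  -- Step 3: the body at `N := X + Y + Z`
  have hN0 : 0 ≤ X + Y + Z := by positivity
  have hP := hbody φ hLan hsupp (X + Y + Z) hN0 hi hii hiii
  have hRHS : B₀ * (X + Y + Z) = B₀ * (X + Y) + B₀ * Z := by ring
  have hBN0 : 0 ≤ B₀ * (X + Y + Z) := by positivity
  refine ⟨?_, ?_, ?_, ?_⟩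
  · -- `|φ|₍₋₁₎`
    rw [← hRHS]
    refine msup_le hBN0 fun j hj b hb => ?_
    rw [hw1]
    exact (hP j hj b.1 b.2 hb).1
  · -- `|∇φ|₍₋₂₎`
    rw [← hRHS]
    refine msup_le hBN0 fun j hj t ht => ?_
    rw [hw2]
    exact (hP j hj t.2.2 t.2.1 ht).2.1 t.1
  · -- `|∂*∂φ|₍₋₃₎ = |J|₍₋₃₎ = X ≤ B₀(X + Y) + B₀Z` (`B₀ ≥ 1`)
    have h1 : X ≤ B₀ * X := le_mul_of_one_le_left hX0 hB₀
    nlinarith [h1, hY0, hZ0, hB₀0]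
  · -- `|Δφ|₍₋₃₎`
    rw [← hRHS]
    refine msup_le hBN0 fun j hj b hb => ?_
    rw [hw3]
    exact (hP j hj b.1 b.2 (hbs b.1 b.2 j hb)).2.2


/-! ## §2 Print's full class of the dented RECORD member at every truncation lies in the γ split index (transported from the engine through the label shift) -/

section Classes

variable {L K : ℕ} {Ω : ℕ → Set (Site d)} (c : CubeB8DZ d L K Ω)

/-- `x + t ∈ S + t ↔ x ∈ S`. [folklore] [cite: Balaban1987RG1, (0.3) p.252 (bookkeeping)] -/
private theorem add_mem_image_add_iff (S : Set (Site d)) (t x : Site d) : x + t ∈ (fun y => y + t) '' S ↔ x ∈ S :=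
  ⟨fun ⟨y, hy, h⟩ => by rwa [← add_right_cancel h], fun hx => ⟨x, hx, rfl⟩⟩

/-- A level-0 crossing bond of `Ω′₀` is a crossing bond of `Ω′₀ + t` after the shift. [cite: Balaban1985RegularSpaces, p.77 (convention before (1.5)); Balaban1987RG1, (0.3) p.252] -/
private theorem crossB_translate_iff (S : Set (Site d)) (t : Site d) (b : Site d × Fin d) :
    CrossB ((fun y => y + t) '' S) (b.1 + t, b.2) ↔ CrossB S b := by
  unfold CrossB
  rw [bondTouches_translate_iff, show b.1 + t + e b.2 = (b.1 + e b.2) + t by abel, add_mem_image_add_iff, add_mem_image_add_iff]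

/-- ★ (RECORD TWIN of `B8Ineq159FlatDentedCubeMemberSCGamma.lamBPF_sub_splitIndex`.) **PRINT'S FULL CLASS OF THE DENTED RECORD MEMBER LIES IN THE γ SPLIT INDEX** at every
truncation `1 ≤ m ≤ k`: the bonds of print's class (`cubeLamBPZ … m j` below the top, `c.lamBPZ j` at the top) are bonds of the split class `c.lamBPT m j` or level-0 crossing
bonds of `Ω′₀` — the engine's inclusion at the translated datum `c.translate`, read back through the label shift `z ↦ z + c_{k−j}` (odd `L = 2s+1`).
[cite: Balaban1985RegularSpaces, (1.31) p.82, p.77; Balaban1984PropagatorsII, (2.3) p.224; Balaban1985Variational, (148)–(150) p.301; Balaban1987RG1, (0.3) p.252] -/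
theorem lamBPF_sub_splitIndex {s : ℕ} (hLs : L = 2 * s + 1) {m : ℕ} (hm1 : 1 ≤ m) (hmk : m ≤ c.k) :
    ∀ j, j ≤ m → ∀ b, b ∈ (if m < c.k then cubeLamBPZ L c.a c.M c.ρ c.k m j else c.lamBPZ j) →
      (b ∈ c.lamBPT m j ∨ (j = 0 ∧ CrossB (c.sq 0) b)) := by
  have hL : Odd L := ⟨s, by omega⟩
  have hL1 : 1 ≤ L := by omega
  intro j hj b hb
  have hjk : j ≤ c.k := hj.trans hmk
  -- the shifted bond lies in the engine's full class of the translated datum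
  have hb' : ((b.1 + fun _ => (ctrShift L (c.k - j) : ℤ)), b.2) ∈ (c.translate hL).lamBPF m j := by
    rcases lt_or_eq_of_le hmk with hlt | heq
    · rw [if_pos hlt] at hb
      rw [lamBPF_of_lt (c.translate hL) (show m < (c.translate hL).k from hlt)]
      exact (mem_cubeLamBPZ_iff_add_ctrShift L c.a c.M c.ρ c.k m j b).1 hb
    · subst heq
      rw [if_neg (lt_irrefl _)] at hb
      have htop : (c.translate hL).lamBPF c.k j = (c.translate hL).lamBP j := lamBPF_top (c.translate hL) j
      rw [htop]
      exact (c.mem_lamBPZ_iff_add_ctrShift hL j b).1 hb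
  rcases B8Ineq159FlatDentedCubeMemberSCGamma.lamBPF_sub_splitIndex (c.translate hL) hL1 hm1 hmk j hj _ hb' with h | ⟨hj0, h⟩
  · exact Or.inl ((mem_lamBPT_iff_add_ctrShift hLs c hjk b).2 h)
  · refine Or.inr ⟨hj0, ?_⟩
    subst hj0
    rw [← c.image_add_ctrShift_sq hL 0, Nat.sub_zero] at h
    exact (crossB_translate_iff (c.sq 0) _ b).1 h

end Classes

/-! ## §3 The UNIFORM four-line clause at every truncation of the dented member, from the two named facts -/

section Uniform

variable {L : ℕ}

/-- ★★ **THE SCALAR FOUR-LINE (1.59) CLAUSE AT `U₀ = 1`, UNIFORMLY ON PRINT's BIG-BLOCK SUB-LATTICE, AT EVERY TRUNCATION OF EVERY DENTED MEMBER, FROM THE TWO NAMED FACTS** — the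
pure `Ineq159FlatCubeMemberPrinted d L` (truncations `m < k`: the truncated dented tower IS the pure member's; [4] Thm 3.3 at `U = 1` on the Dirichlet cube, PROVED in the tree
for odd `L ≥ 5`) and the dented `Ineq159FlatDentedCubeMemberPrinted d L` (the top truncation `m = k` of [15]'s local sequence `{Ω′_j}`; OPEN): one constant `B₀ ≥ 1` and thresholds
`ρ₀, M₀, N₀, R₀` such that at every dented datum `c` of the sub-lattice (`M_h = Lˢ`: `M₀ ≤ L^{s+1}`, `L^{s+1} ∣ c.ρ`, `L^{s+1} ∣ c.M`, `R·L^{s+1} ≤ c.ρ`, `R₀ ≤ R`, `N₀ + 1 ≤ R·L^{s+1}`,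
`ρ₀ ≤ c.ρ`) whose `Ω_k` is a union of `L^{s+1}Lᵏ`-cubes of the grid anchored at `□_k`'s corner, every truncation `1 ≤ m ≤ c.k`, every index predicate `I ⊇ c.lamBPF m` and every `φ`
in the flat Landau gauge for `(Ω′₀, c.lamST m)` with the support clause, the four-line clause of §1 holds over the dented tower with `B_∂ := B₀`.
[cite: Balaban1985RegularSpaces, (1.59) p.86, (1.62) p.87, (1.31) p.82, (1.131)–(1.132) p.99, p.98; Balaban1985Variational, (148)–(152) p.301; Balaban1985BackgroundPropagators, Thm 3.3 p.399; Balaban1984PropagatorsII, Prop. 2.6 (2.136) p.247, (2.3) p.224] -/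
theorem sc4_dented_of_ineq159Printed (hd2 : 2 ≤ d) {s : ℕ} (hLs : L = 2 * s + 1) (h159 : Ineq159FlatCubeMemberCovPrintedZ d L)
    (h159D : Ineq159FlatDentedCubeMemberCovPrintedZ d L) :
    ∃ B₀ ρ₀ M₀ : ℝ, ∃ N₀ R₀ : ℕ, 1 ≤ B₀ ∧
    ∀ (η : ℝ), 0 < η → ∀ {K : ℕ} {Ω : ℕ → Set (Site d)} (c : CubeB8DZ d L K Ω) (s R : ℕ),
      M₀ ≤ (L : ℝ) ^ (s + 1) → L ^ (s + 1) ∣ c.ρ → L ^ (s + 1) ∣ c.M → R * L ^ (s + 1) ≤ c.ρ → R₀ ≤ R →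
      N₀ + 1 ≤ R * L ^ (s + 1) → ρ₀ ≤ (c.ρ : ℝ) →
      (∀ x y : Site d,
          blockMap (L ^ (s + 1) * L ^ c.k) (x - fun i => (L : ℤ) ^ c.k * (c.a i - c.ρ) - (ctrShift L c.k : ℤ)) =
            blockMap (L ^ (s + 1) * L ^ c.k) (y - fun i => (L : ℤ) ^ c.k * (c.a i - c.ρ) - (ctrShift L c.k : ℤ)) → x ∈ Ω c.k → y ∈ Ω c.k) →
      ∀ m, 1 ≤ m → m ≤ c.k → ∀ (I : ℕ → Site d × Fin d → Prop),
        (∀ j, j ≤ m → ∀ b, b ∈ (if m < c.k then cubeLamBPZ L c.a c.M c.ρ c.k m j else c.lamBPZ j) → I j b) →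
      ∀ φ : Site d → Fin d → ℂ,
        IsLandau138Z L m η (c.sq 0) (c.lamST m) (1 : Site d → Fin d → ℂˣ) φ →
        (∀ (y : Site d) (τ : Fin d), (∀ j, j ≤ m → ¬ SideTouches (c.sq j) y τ) → φ y τ = 0) →
        msup L m η (-(1 : ℝ)) (fun j (b : Site d × Fin d) => SideTouches (c.sq j) b.1 b.2) (fun b => φ b.1 b.2)
            ≤ B₀ * (bondNorm L m η (-(3 : ℝ)) c.sq (fun x μ => Jcur η (1 : Site d → Fin d → ℂˣ) φ μ x)
              + wsup 1 (fun p : {p : ℕ × (Site d × Fin d) // p.1 ≤ m ∧ I p.1 p.2} =>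
                  linCovIterZ L (1 : Site d → Fin d → ℂˣ) (iEta η φ) p.1.1 p.1.2.1 p.1.2.2))
              + B₀ * msup L m η (-(1 : ℝ)) (fun j (b : Site d × Fin d) => j = 0 ∧ SideTouches (c.sq 0) b.1 b.2 ∧
                  ¬ BondTouches (c.sq 0) b.1 b.2) (fun b => φ b.1 b.2) ∧
          msup L m η (-(2 : ℝ)) (fun j (t : Fin d × Fin d × Site d) => SideTouches (c.sq j) t.2.2 t.2.1)
              (fun t => covDerivFwd η (1 : Site d → Fin d → ℂˣ) t.1 (fun z => φ z t.2.1) t.2.2)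
            ≤ B₀ * (bondNorm L m η (-(3 : ℝ)) c.sq (fun x μ => Jcur η (1 : Site d → Fin d → ℂˣ) φ μ x)
              + wsup 1 (fun p : {p : ℕ × (Site d × Fin d) // p.1 ≤ m ∧ I p.1 p.2} =>
                  linCovIterZ L (1 : Site d → Fin d → ℂˣ) (iEta η φ) p.1.1 p.1.2.1 p.1.2.2))
              + B₀ * msup L m η (-(1 : ℝ)) (fun j (b : Site d × Fin d) => j = 0 ∧ SideTouches (c.sq 0) b.1 b.2 ∧
                  ¬ BondTouches (c.sq 0) b.1 b.2) (fun b => φ b.1 b.2) ∧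
          bondNorm L m η (-(3 : ℝ)) c.sq
              (fun x μ => pdiv η (1 : Site d → Fin d → ℂˣ) (plaqCovDeriv η (1 : Site d → Fin d → ℂˣ) φ) μ x)
            ≤ B₀ * (bondNorm L m η (-(3 : ℝ)) c.sq (fun x μ => Jcur η (1 : Site d → Fin d → ℂˣ) φ μ x)
              + wsup 1 (fun p : {p : ℕ × (Site d × Fin d) // p.1 ≤ m ∧ I p.1 p.2} =>
                  linCovIterZ L (1 : Site d → Fin d → ℂˣ) (iEta η φ) p.1.1 p.1.2.1 p.1.2.2))
              + B₀ * msup L m η (-(1 : ℝ)) (fun j (b : Site d × Fin d) => j = 0 ∧ SideTouches (c.sq 0) b.1 b.2 ∧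
                  ¬ BondTouches (c.sq 0) b.1 b.2) (fun b => φ b.1 b.2) ∧
          bondNorm L m η (-(3 : ℝ)) c.sq (fun x μ => covLap η (1 : Site d → Fin d → ℂˣ) (fun z => φ z μ) x)
            ≤ B₀ * (bondNorm L m η (-(3 : ℝ)) c.sq (fun x μ => Jcur η (1 : Site d → Fin d → ℂˣ) φ μ x)
              + wsup 1 (fun p : {p : ℕ × (Site d × Fin d) // p.1 ≤ m ∧ I p.1 p.2} =>
                  linCovIterZ L (1 : Site d → Fin d → ℂˣ) (iEta η φ) p.1.1 p.1.2.1 p.1.2.2))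
              + B₀ * msup L m η (-(1 : ℝ)) (fun j (b : Site d × Fin d) => j = 0 ∧ SideTouches (c.sq 0) b.1 b.2 ∧
                  ¬ BondTouches (c.sq 0) b.1 b.2) (fun b => φ b.1 b.2) := by
  obtain ⟨B₀, ρ₀, M₀, N₀, R₀, hB₀, H⟩ := h159
  obtain ⟨B₁, ρ₁, M₁, N₁, R₁, hB₁, HD⟩ := h159D
  refine ⟨max (max B₀ B₁) 1, max ρ₀ ρ₁, max M₀ M₁, max N₀ N₁, max R₀ R₁, le_max_right _ _, ?_⟩
  intro η hη K Ω c s R hM₀ hdρ hdM hR hR₀ hN₀ hρ₀ hΩ m hm1 hmk I hI φ hLan hsupp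
  have hk := c.one_le_k
  have hρL : L ≤ c.ρ := c.L_le_ρ
  have hL : 1 ≤ L := by omega
  have hB : max B₀ B₁ ≤ max (max B₀ B₁) 1 := le_max_left _ _
  have hM₀' : M₀ ≤ (L : ℝ) ^ (s + 1) := (le_max_left _ _).trans hM₀
  have hM₁' : M₁ ≤ (L : ℝ) ^ (s + 1) := (le_max_right _ _).trans hM₀
  have hR₀' : R₀ ≤ R := (le_max_left _ _).trans hR₀
  have hR₁' : R₁ ≤ R := (le_max_right _ _).trans hR₀
  have hN₀' : N₀ + 1 ≤ R * L ^ (s + 1) := le_trans (Nat.succ_le_succ (le_max_left _ _)) hN₀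
  have hN₁' : N₁ + 1 ≤ R * L ^ (s + 1) := le_trans (Nat.succ_le_succ (le_max_right _ _)) hN₀
  have hρ₀' : ρ₀ ≤ (c.ρ : ℝ) := (le_max_left _ _).trans hρ₀
  have hρ₁' : ρ₁ ≤ (c.ρ : ℝ) := (le_max_right _ _).trans hρ₀
  refine sc4_of_pointwise159_dented hd2 hLs hη c hmk (le_max_right _ _) (fun j => if m < c.k then cubeLamBPZ L c.a c.M c.ρ c.k m j else c.lamBPZ j) I hI
    (fun ψ hψ hψ0 N hN h1 h2 h3 j hj y τ hs => ?_) φ hLan hsupp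
  rcases lt_or_eq_of_le hmk with hlt | heq
  · -- `m < k`: the truncated dented tower is the pure member's — the PURE fact, letter by letter
    have hsqj : ∀ j', j' ≤ m → c.sq j' = cubeFamZ false L c.a c.M c.ρ c.k j' := fun j' hj' => by
      rw [c.sq_of_lt (lt_of_le_of_lt hj' hlt), cubeFam_false_of_le L c.a c.M c.ρ (hj'.trans hmk)]
    have hψ' : IsLandau138Z L m η (cubeFamZ false L c.a c.M c.ρ c.k 0) (cubeLamSZ L c.a c.M c.ρ c.k m) (1 : Site d → Fin d → ℂˣ) ψ := by
      rw [← hsqj 0 (Nat.zero_le m), ← lamST_of_lt c hlt]; exact hψ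
    have hψ0' : ∀ (y : Site d) (τ : Fin d), (∀ j', j' ≤ m → ¬ SideTouches (cubeFamZ false L c.a c.M c.ρ c.k j') y τ) → ψ y τ = 0 :=
      fun y τ h => hψ0 y τ fun j' hj' => by rw [hsqj j' hj']; exact h j' hj'
    have h1' : ∀ j', j' ≤ m → ∀ (y : Site d) (τ : Fin d), BondTouches (cubeFamZ false L c.a c.M c.ρ c.k j') y τ →
        ((L : ℝ) ^ j' * η) ^ 3 * ‖Jcur η (1 : Site d → Fin d → ℂˣ) ψ τ y‖ ≤ N :=
      fun j' hj' y τ hb => h1 j' hj' y τ (by rw [hsqj j' hj']; exact hb)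
    have h2' : ∀ j', j' ≤ m → ∀ b ∈ cubeLamBPZ L c.a c.M c.ρ c.k m j',
        ‖linCovIterZ L (1 : Site d → Fin d → ℂˣ) (iEta η ψ) j' b.1 b.2‖ ≤ N :=
      fun j' hj' b hb => h2 j' hj' b (by show b ∈ (if m < c.k then _ else _); rw [if_pos hlt]; exact hb)
    have h3' : ∀ (y : Site d) (τ : Fin d), ¬ BondTouches (cubeFamZ false L c.a c.M c.ρ c.k 0) y τ → η * ‖ψ y τ‖ ≤ N :=
      fun y τ hb => h3 y τ (by rw [hsqj 0 (Nat.zero_le m)]; exact hb)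
    have hs' : SideTouches (cubeFamZ false L c.a c.M c.ρ c.k j) y τ := by rw [← hsqj j hj]; exact hs
    obtain ⟨q1, q2, q3⟩ := H η hη c.a c.M c.ρ c.k s R hk hM₀' hdρ hdM hR hR₀' hN₀' hρ₀' m hm1 hmk ψ hψ' hψ0' N hN h1' h2' h3' j hj y τ hs'
    have hmono : B₀ * N ≤ max (max B₀ B₁) 1 * N := mul_le_mul_of_nonneg_right ((le_max_left _ _).trans hB) hN
    exact ⟨q1.trans hmono, fun ν => (q2 ν).trans hmono, q3.trans hmono⟩
  · -- `m = k`: the DENTED fact verbatim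
    subst heq
    have hT : c.lamST c.k = c.lamS := funext (lamST_top_apply c)
    have hψ' : IsLandau138Z L c.k η (c.sq 0) c.lamS (1 : Site d → Fin d → ℂˣ) ψ := by rw [← hT]; exact hψ
    have h2' : ∀ j', j' ≤ c.k → ∀ b ∈ c.lamBPZ j',
        ‖linCovIterZ L (1 : Site d → Fin d → ℂˣ) (iEta η ψ) j' b.1 b.2‖ ≤ N :=
      fun j' hj' b hb => h2 j' hj' b (by show b ∈ (if c.k < c.k then _ else _); rw [if_neg (lt_irrefl _)]; exact hb)
    obtain ⟨q1, q2, q3⟩ := HD η hη K Ω c s R hM₁' hdρ hdM hR hR₁' hN₁' hρ₁' hΩ ψ hψ' hψ0 N hN h1 h2' h3 j hj y τ hs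
    have hmono : B₁ * N ≤ max (max B₀ B₁) 1 * N := mul_le_mul_of_nonneg_right ((le_max_right _ _).trans hB) hN
    exact ⟨q1.trans hmono, fun ν => (q2 ν).trans hmono, q3.trans hmono⟩

end Uniform

end Literature.MathematicalPhysics.QuantumFieldTheory.Balaban1983to89.B8Ineq159FlatDentedCubeMemberSCGammaRec

end
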